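import Summits.ValiantsHypothesis.ValiantsHypothesis.Theorems.MonotoneRestorationOrbitRestorationQPAltFixMain
import Summits.ValiantsHypothesis.ValiantsHypothesis.Theorems.MonotoneRestorationOrbitRestorationQPDerivativeTowerWaringFamily
import Summits.ValiantsHypothesis.ValiantsHypothesis.Theorems.MonotoneRestorationOrbitRestorationQPDerivativeGradedWaring
import Summits.ValiantsHypothesis.ValiantsHypothesis.Theorems.MonotoneRestorationOrbitRestorationQPDerivativeTowerCatalecticant
import HarnessLib

/-!
# Small diagonally-stable modules are alt-spanned; the ΣΛΣ sub-rung of A_∞ is UNCONDITIONAL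

Route MonotoneRestoration, crux `OrbitRestorationQP` (stmt-ValiantsHypothesis-18293), line `depth-three-rung`,
stub A_∞ `stub_sigmaPiSigmaValue`.  Namespace `Summit.ValiantsHypothesis.ValiantsHypothesis.Theorems.AltFix` /
`…DerivativeTower`.

`…DerivativeTowerWaringAlt.lean`, `…DerivativeTowerWaringFamily.lean`, `…DerivativeGradedWaring.lean` and
`…DerivativeTowerCatalecticant.lean` proved the ΣΛΣ sub-rung of A_∞ (sums of polynomially many powers of
linear / affine forms, any degrees; more generally polynomial catalecticant rank) MODULO one hypothesis `hKey`:
every finite-dimensional matrix-stable subspace of dimension `≤ r` is spanned by its members fixed by all even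
permutations fixing `≤ k` indices.  From `AltFix.altFix` (small representations of `Sym (Fin n)` have
alternating-fixed vectors) we now PROVE that hypothesis for dimension `≤ n^c + c`, `n ≥ n₀(c)`, `k = 3c`, even
for subspaces stable only under the DIAGONAL action (`smallModules_altSpanning`: pass to the quotient by the
span of the alt-supported members, find an alternating-fixed vector there, average it over the finite group),
and discharge the conditionals:

* `sigmaLambdaSigma_restoration` — **every matrix-symmetric family `f n = Σ_{i < r n} a_i ℓ_{w_i}^{d n}` with
  `r n ≤ n^c + c` is quasi-polynomially orbit-restorable** (unconditional);
* `sigmaLambdaSigma_affine_restoration` — the same for powers of AFFINE forms `(ℓ_{w_i} + b_i)^{d n}`;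
* `smallDerivChain_restoration` — the same for matrix-symmetric homogeneous families all of whose derivative
  spaces have dimension `≤ n^c + c` (polynomial catalecticant rank).

Honest label: this closes the ΣΛΣ (depth-3 powering) SUB-RUNG of stub A_∞ unconditionally; ΣΠΣ with many
distinct affine forms per product, A_∞ itself, the crux and VP ≠ VNP remain open. [folklore]
-/

noncomputable section

open scoped Classical

-- `Summit.ValiantsHypothesis.ValiantsHypothesis.…` is the tree's single-conjunct layout (Sub = Summit).
set_option linter.dupNamespace false

namespace Summit.ValiantsHypothesis.ValiantsHypothesis.Theorems

namespace AltFix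

open MvPolynomial Equiv Equiv.Perm Module Module.End

/-- **SMALL DIAGONALLY-STABLE MODULES ARE ALT-SPANNED.**  For every `c` there are `k = 3c` and `n₀` such that
for `n ≥ n₀` every finite-dimensional subspace `W` of polynomials on the `n × n` matrix with
`finrank W ≤ n^c + c`, stable under the diagonal renaming action `ren ρ` of `Sym (Fin n)`, is contained in the
span of its members fixed by every even permutation fixing pointwise some `≤ k` indices. [folklore] -/
theorem smallModules_altSpanning (c : ℕ) : ∃ k n₀ : ℕ, ∀ n : ℕ, n₀ ≤ n →
    ∀ W : Submodule ℂ (MvPolynomial (Fin n × Fin n) ℂ), FiniteDimensional ℂ W →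
      Module.finrank ℂ W ≤ n ^ c + c → (∀ ρ : Perm (Fin n), ∀ w ∈ W, ren ρ w ∈ W) →
        W ≤ Submodule.span ℂ {v | v ∈ W ∧ ∃ Y : Finset (Fin n), Y.card ≤ k ∧
          ∀ ρ : Perm (Fin n), (∀ i ∈ Y, ρ i = i) → Perm.sign ρ = 1 → ren ρ v = v} := by
  obtain ⟨n₀, hn₀⟩ := altFix c
  refine ⟨3 * c, n₀, fun n hn W hWfd hdim hstab => ?_⟩
  haveI := hWfd
  set A : Set (MvPolynomial (Fin n × Fin n) ℂ) := {v | v ∈ W ∧ ∃ Y : Finset (Fin n), Y.card ≤ 3 * c ∧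
    ∀ ρ : Perm (Fin n), (∀ i ∈ Y, ρ i = i) → Perm.sign ρ = 1 → ren ρ v = v} with hA
  set F := Submodule.span ℂ A with hF
  by_contra hWF
  -- `A` (hence `F`) is stable under the diagonal action
  have hAst : ∀ ρ : Perm (Fin n), ∀ v ∈ A, ren ρ v ∈ A := by
    rintro ρ v ⟨hvW, Y, hYk, hY⟩
    refine ⟨hstab ρ v hvW, Y.image ρ, Finset.card_image_le.trans hYk, fun ρ' hρ' hs' => ?_⟩
    have hconj : ∀ i ∈ Y, (ρ⁻¹ * ρ' * ρ) i = i := by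
      intro i hi
      have := hρ' (ρ i) (Finset.mem_image_of_mem ρ hi)
      rw [Perm.mul_apply, Perm.mul_apply, this]
      simp
    have hsconj : Perm.sign (ρ⁻¹ * ρ' * ρ) = 1 := by simp [hs']
    calc ren ρ' (ren ρ v) = ren ρ (ren (ρ⁻¹ * ρ' * ρ) v) := by
          rw [← ren_mul, ← ren_mul]; congr 1; group
      _ = ren ρ v := by rw [hY _ hconj hsconj]
  have hFst : ∀ ρ : Perm (Fin n), ∀ v ∈ F, ren ρ v ∈ F := by
    intro ρ v hv
    have h1 : F.map (ren ρ).toLinearMap ≤ F := by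
      rw [hF, Submodule.map_span, Submodule.span_le]
      rintro _ ⟨u, hu, rfl⟩
      exact Submodule.subset_span (hAst ρ u hu)
    exact h1 ⟨v, hv, rfl⟩
  -- the quotient of `W` by `F ∩ W`
  let F' : Submodule ℂ W := F.comap W.subtype
  have hF'top : F' ≠ ⊤ := by
    intro h
    apply hWF
    intro w hw
    have : (⟨w, hw⟩ : W) ∈ F' := by rw [h]; trivial
    exact this
  let renW : Perm (Fin n) → (W →ₗ[ℂ] W) := fun ρ =>
    (ren ρ).toLinearMap.restrict (p := W) (q := W) fun w hw => hstab ρ w hw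
  have hrenW : ∀ ρ (w : W), ((renW ρ w : W) : MvPolynomial (Fin n × Fin n) ℂ) = ren ρ (w : _) :=
    fun ρ w => rfl
  have hF'st : ∀ ρ, F' ≤ F'.comap (renW ρ) := by
    intro ρ w hw
    show ((renW ρ w : W) : MvPolynomial (Fin n × Fin n) ℂ) ∈ F
    rw [hrenW]; exact hFst ρ _ hw
  let actQ : Perm (Fin n) → Module.End ℂ (W ⧸ F') := fun ρ => F'.mapQ F' (renW ρ) (hF'st ρ)
  have hactQ : ∀ ρ (w : W), actQ ρ (Submodule.Quotient.mk w) = Submodule.Quotient.mk (renW ρ w) :=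
    fun ρ w => rfl
  have hrenW1 : ∀ w : W, renW 1 w = w := fun w => Subtype.ext (by rw [hrenW, ren_one])
  have hrenWmul : ∀ g h (w : W), renW (g * h) w = renW g (renW h w) := fun g h w =>
    Subtype.ext (by rw [hrenW, hrenW, hrenW, ren_mul])
  let ρQ : Perm (Fin n) →* Module.End ℂ (W ⧸ F') :=
    { toFun := actQ
      map_one' := by
        refine Submodule.linearMap_qext _ (LinearMap.ext fun w => ?_)
        simp only [LinearMap.comp_apply, Submodule.mkQ_apply, Module.End.one_apply, hactQ, hrenW1]
      map_mul' := fun g h => by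
        refine Submodule.linearMap_qext _ (LinearMap.ext fun w => ?_)
        simp only [LinearMap.comp_apply, Submodule.mkQ_apply, Module.End.mul_apply, hactQ, hrenWmul] }
  haveI : Nontrivial (W ⧸ F') := Submodule.Quotient.nontrivial_iff.mpr hF'top
  have hdimQ : Module.finrank ℂ (W ⧸ F') ≤ n ^ c + c := (Submodule.finrank_quotient_le F').trans hdim
  obtain ⟨Y, hYk, q, hq0, hqfix⟩ := hn₀ n hn (W ⧸ F') ρQ hdimQ
  obtain ⟨w, rfl⟩ := Submodule.Quotient.mk_surjective F' q
  have hwF : (w : MvPolynomial (Fin n × Fin n) ℂ) ∉ F := fun h =>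
    hq0 ((Submodule.Quotient.mk_eq_zero F').mpr h)
  -- the pointwise stabiliser of `Y` inside the alternating group, as a finset
  set G := (Finset.univ : Finset (Perm (Fin n))).filter fun ρ =>
    (∀ i ∈ Y, ρ i = i) ∧ Perm.sign ρ = 1 with hG
  have hGmem : ∀ ρ, ρ ∈ G ↔ (∀ i ∈ Y, ρ i = i) ∧ Perm.sign ρ = 1 := fun ρ => by simp [hG]
  have h1G : (1 : Perm (Fin n)) ∈ G := (hGmem 1).mpr ⟨fun _ _ => rfl, Perm.sign_one⟩
  have hGmul : ∀ ρ' ∈ G, ∀ ρ, ρ ∈ G ↔ ρ' * ρ ∈ G := by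
    intro ρ' hρ' ρ
    obtain ⟨h1, h2⟩ := (hGmem ρ').mp hρ'
    rw [hGmem, hGmem]
    constructor
    · rintro ⟨h3, h4⟩
      exact ⟨fun i hi => by rw [Perm.mul_apply, h3 i hi, h1 i hi], by rw [Perm.sign_mul, h2, h4, one_mul]⟩
    · rintro ⟨h3, h4⟩
      refine ⟨fun i hi => ?_, ?_⟩
      · have := h3 i hi
        rw [Perm.mul_apply] at this
        exact ρ'.injective (this.trans (h1 i hi).symm)
      · rw [Perm.sign_mul, h2, one_mul] at h4; exact h4
  -- every `ρ ∈ G` moves `w` inside `F`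
  have hmove : ∀ ρ ∈ G, ren ρ (w : MvPolynomial (Fin n × Fin n) ℂ) - w ∈ F := by
    intro ρ hρ
    obtain ⟨h1, h2⟩ := (hGmem ρ).mp hρ
    have h3 := hqfix ρ h1 h2
    change actQ ρ (Submodule.Quotient.mk w) = Submodule.Quotient.mk w at h3
    rw [hactQ, Submodule.Quotient.eq] at h3
    exact h3
  -- the average is alt-supported on `Y`, hence in `A ⊆ F`
  set v' := ∑ ρ ∈ G, ren ρ (w : MvPolynomial (Fin n × Fin n) ℂ) with hv'
  have hv'A : v' ∈ A := by
    refine ⟨Submodule.sum_mem _ fun ρ _ => hstab ρ _ w.2, Y, hYk, fun ρ' hρ' hs' => ?_⟩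
    have hρ'G : ρ' ∈ G := (hGmem ρ').mpr ⟨hρ', hs'⟩
    rw [hv', map_sum]
    simp_rw [← ren_mul]
    exact Finset.sum_equiv (Equiv.mulLeft ρ') (fun ρ => by
      simpa only [Equiv.coe_mulLeft] using hGmul ρ' hρ'G ρ) (fun ρ _ => rfl)
  have hv'F : v' ∈ F := Submodule.subset_span hv'A
  -- so `|G| • w ∈ F`, and `w ∈ F`: contradiction
  have hsum : v' - ∑ ρ ∈ G, (ren ρ (w : MvPolynomial (Fin n × Fin n) ℂ) - w) =
      (G.card : ℂ) • (w : MvPolynomial (Fin n × Fin n) ℂ) := by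
    rw [hv', Finset.sum_sub_distrib, Finset.sum_const, sub_sub_cancel, Nat.cast_smul_eq_nsmul]
  have hGw : (G.card : ℂ) • (w : MvPolynomial (Fin n × Fin n) ℂ) ∈ F := by
    rw [← hsum]
    exact Submodule.sub_mem _ hv'F (Submodule.sum_mem _ fun ρ hρ => hmove ρ hρ)
  have hGpos : (G.card : ℂ) ≠ 0 := by
    have : 0 < G.card := Finset.card_pos.mpr ⟨1, h1G⟩
    exact_mod_cast this.ne'
  apply hwF
  have := F.smul_mem ((G.card : ℂ)⁻¹) hGw
  rwa [smul_smul, inv_mul_cancel₀ hGpos, one_smul] at this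

end AltFix

namespace DerivativeTower

open MvPolynomial Finset Equiv OrbitRestorationQPDepthThreeRung WaringJennrich LevelStructure

/-- **THE ΣΛΣ SUB-RUNG OF A_∞, UNCONDITIONAL (linear forms).**  Every matrix-symmetric family with
`f n = Σ_{i < r n} a_i ℓ_{w_i}^{d n}`, `r n ≤ n^c + c` (arbitrary forms, coefficients, degrees), is
quasi-polynomially orbit-restorable. [folklore] -/
theorem sigmaLambdaSigma_restoration {c : ℕ}
    (f : (n : ℕ) → MvPolynomial (Fin n × Fin n) ℂ) (hsym : IsMatrixSymmetric f) (r d : ℕ → ℕ)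
    (hr : ∀ n, r n ≤ n ^ c + c)
    (h : ∀ n : ℕ, ∃ (w : Fin (r n) → (Fin n × Fin n) → ℂ) (a : Fin (r n) → ℂ),
      f n = ∑ i, C (a i) * lin (w i) ^ (d n)) :
    ∃ c' : ℕ, ∀ n : ℕ, QPOrbitRestorable c' n (f n) := by
  obtain ⟨k, n₀, hk⟩ := AltFix.smallModules_altSpanning c
  exact sigmaLambdaSigma_restoration_of_eventually_altSpanning (k := k) (n₀ := n₀) f hsym r d
    (fun n hn W hW hdim hst => hk n hn W hW (hdim.trans (hr n))
      fun ρ w hw => by rw [ren_eq_mact]; exact hst ρ ρ w hw) h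

/-- **THE ΣΛΣ SUB-RUNG OF A_∞, UNCONDITIONAL (affine forms).**  Every matrix-symmetric family with
`f n = Σ_{i < r n} a_i (ℓ_{w_i} + b_i)^{d n}`, `r n ≤ n^c + c`, is quasi-polynomially orbit-restorable.
[folklore] -/
theorem sigmaLambdaSigma_affine_restoration {c : ℕ}
    (f : (n : ℕ) → MvPolynomial (Fin n × Fin n) ℂ) (hsym : IsMatrixSymmetric f) (r d : ℕ → ℕ)
    (hr : ∀ n, r n ≤ n ^ c + c)
    (h : ∀ n : ℕ, ∃ (w : Fin (r n) → (Fin n × Fin n) → ℂ) (b a : Fin (r n) → ℂ),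
      f n = ∑ i, C (a i) * (lin (w i) + C (b i)) ^ (d n)) :
    ∃ c' : ℕ, ∀ n : ℕ, QPOrbitRestorable c' n (f n) := by
  obtain ⟨k, n₀, hk⟩ := AltFix.smallModules_altSpanning c
  refine ⟨n₀.factorial + k + 7, fun n => ?_⟩
  by_cases hn : n₀ ≤ n
  · obtain ⟨w, b, a, hf⟩ := h n
    refine Restorable.qpOrbitRestorable_mono (by omega)
      (sigmaLambdaSigma_affine_restorable_of_smallModulesAltSupported (k := k) (r := r n) (d := d n)
        (fun W hW hdim hst => hk n hn W hW (hdim.trans (hr n))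
          fun ρ w' hw' => by rw [ren_eq_mact]; exact hst ρ ρ w' hw') w b a hf fun σ τ => ?_)
    rw [mact_apply]; exact hsym n σ τ
  · refine Restorable.qpOrbitRestorable_mono ?_
      (Restorable.qpOrbitRestorable_of_invariant (f n) fun σ => ValueOrbit.ren_eq_of_matrixSymmetric (hsym n) σ)
    have : n.factorial ≤ n₀.factorial := Nat.factorial_le (by omega)
    omega

/-- **POLYNOMIAL CATALECTICANT RANK, UNCONDITIONAL.**  Every matrix-symmetric family of homogeneous
polynomials all of whose derivative spaces `derivChain (f n) m` have dimension `≤ n^c + c` is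
quasi-polynomially orbit-restorable. [folklore] -/
theorem smallDerivChain_restoration {c : ℕ}
    (f : (n : ℕ) → MvPolynomial (Fin n × Fin n) ℂ) (hsym : IsMatrixSymmetric f) (d : ℕ → ℕ)
    (hhom : ∀ n, (f n).IsHomogeneous (d n))
    (hrank : ∀ n m, FiniteDimensional ℂ (derivChain (f n) m) ∧
      Module.finrank ℂ (derivChain (f n) m) ≤ n ^ c + c) :
    ∃ c' : ℕ, ∀ n : ℕ, QPOrbitRestorable c' n (f n) := by
  obtain ⟨k, n₀, hk⟩ := AltFix.smallModules_altSpanning c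
  refine ⟨n₀.factorial + k + 7, fun n => ?_⟩
  by_cases hn : n₀ ≤ n
  · refine Restorable.qpOrbitRestorable_mono (by omega)
      (qpOrbitRestorable_of_smallDerivChain (k := k) (r := n ^ c + c) (d := d n)
        (fun W hW hdim hst => hk n hn W hW hdim fun ρ w' hw' => by rw [ren_eq_mact]; exact hst ρ ρ w' hw')
        (hhom n) (hrank n) fun σ τ => ?_)
    rw [mact_apply]; exact hsym n σ τ
  · refine Restorable.qpOrbitRestorable_mono ?_
      (Restorable.qpOrbitRestorable_of_invariant (f n) fun σ => ValueOrbit.ren_eq_of_matrixSymmetric (hsym n) σ)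
    have : n.factorial ≤ n₀.factorial := Nat.factorial_le (by omega)
    omega

end DerivativeTower

end Summit.ValiantsHypothesis.ValiantsHypothesis.Theorems

end
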